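import Mathlib.RingTheory.Localization.Ideal
import Mathlib.RingTheory.Localization.BaseChange
import Mathlib.Algebra.Module.LocalizedModule.IsLocalization
import Mathlib.Algebra.Module.LocalizedModule.Submodule
import Mathlib.RingTheory.Ideal.Quotient.Operations
import HarnessLib

/-!
# Localizing a surjection of rings: surjectivity, kernel, and quotients as base changes

Topic: `Literature/AlgebraicGeometry/Resolution` (algebraic lemmas for the chart dictionary of
Kawasaki's globalization: a closed subscheme `X ⊆ ℙⁿ` has chart rings `A = B ⧸ K` for the regular
chart rings `B` of `ℙⁿ`, and its local rings and their quotients are base changes of quotients of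
`B` along localizations of `B`).

* `ker_isLocalization_map_of_surjective` — for a surjection `χ : B ↠ A`, a submonoid `P ≤ B`, and
  localizations `B_P`, `A_{χ P}`, the induced map `B_P → A_{χ P}` (Mathlib `IsLocalization.map`,
  surjective by `IsLocalization.map_surjective_of_surjective`) has kernel `(ker χ) B_P`
  (localization is exact);
* `primeCompl_comap_map_eq` — `χ((χ⁻¹𝔮)ᶜ) = 𝔮ᶜ`;
* `isBaseChange_quotientMap` — for an ideal `𝔞 ≤ B` and a localization `B_P`, the quotient map
  `B ⧸ 𝔞 → B_P ⧸ 𝔞 B_P` exhibits `B_P ⧸ 𝔞 B_P` as the base change `(B ⧸ 𝔞) ⊗_B B_P` (Mathlib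
  `IsLocalizedModule.toLocalizedQuotient'` and `isLocalizedModule_iff_isBaseChange`).

Everything is proved; no named facts. All [folklore].
-/

noncomputable section

universe u

namespace Literature.AlgebraicGeometry.Resolution

section Kernel

variable {B A : Type u} [CommRing B] [CommRing A] (χ : B →+* A) (P : Submonoid B)
  (Bₚ Aₚ : Type u) [CommRing Bₚ] [Algebra B Bₚ] [IsLocalization P Bₚ]
  [CommRing Aₚ] [Algebra A Aₚ] [IsLocalization (P.map χ) Aₚ]

/-- `P ≤ χ⁻¹(χ P)`. [folklore] -/
theorem le_comap_map_submonoid : P ≤ (P.map χ).comap χ :=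
  fun _ hx => Submonoid.mem_comap.mpr (Submonoid.mem_map_of_mem χ hx)

/-- **The kernel of a localized surjection is the localized kernel**: for `χ : B → A`, the map
`B_P → A_{χ P}` induced on localizations has kernel `(ker χ) · B_P`. [folklore] -/
theorem ker_isLocalization_map :
    RingHom.ker (IsLocalization.map Aₚ χ (le_comap_map_submonoid χ P) : Bₚ →+* Aₚ) =
      (RingHom.ker χ).map (algebraMap B Bₚ) := by
  refine le_antisymm ?_ (Ideal.map_le_iff_le_comap.mpr fun b hb => ?_)
  · intro y hy
    obtain ⟨⟨b, p⟩, rfl⟩ := IsLocalization.mk'_surjective P y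
    dsimp only at hy ⊢
    rw [RingHom.mem_ker, IsLocalization.map_mk', IsLocalization.mk'_eq_zero_iff] at hy
    obtain ⟨⟨_, q, hq, rfl⟩, hm⟩ := hy
    rw [← map_mul, ← RingHom.mem_ker] at hm
    rw [IsLocalization.mem_map_algebraMap_iff P]
    refine ⟨⟨⟨q * b, hm⟩, ⟨q, hq⟩ * p⟩, ?_⟩
    simp only [Submonoid.coe_mul]
    rw [map_mul, map_mul, ← mul_assoc, mul_comm (IsLocalization.mk' Bₚ b p), mul_assoc,
      IsLocalization.mk'_spec Bₚ b p]
  · rw [RingHom.mem_ker] at hb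
    rw [Ideal.mem_comap, RingHom.mem_ker, IsLocalization.map_eq, hb, map_zero]

/-- For a surjection `χ` and a prime `𝔮 ≤ A`: `χ` maps the complement of `χ⁻¹𝔮` ONTO the complement
of `𝔮`. [folklore] -/
theorem primeCompl_comap_map_eq (hχ : Function.Surjective χ) (𝔮 : Ideal A) [𝔮.IsPrime] :
    (𝔮.comap χ).primeCompl.map χ = 𝔮.primeCompl := by
  ext a
  constructor
  · rintro ⟨b, hb, rfl⟩
    exact hb
  · intro ha
    obtain ⟨b, rfl⟩ := hχ a
    exact ⟨b, ha, rfl⟩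

end Kernel

/-! ## Quotients along localizations are base changes -/

section Quotient

variable {B : Type u} [CommRing B] (P : Submonoid B) (Bₚ : Type u) [CommRing Bₚ] [Algebra B Bₚ]
  [IsLocalization P Bₚ] (𝔞 : Ideal B)

/-- The quotient map `B ⧸ 𝔞 → B_P ⧸ 𝔞 B_P` as a `B`-linear map. [folklore] -/
def quotientMapₗ : (B ⧸ 𝔞) →ₗ[B] (Bₚ ⧸ 𝔞.map (algebraMap B Bₚ)) :=
  (Ideal.quotientMapₐ (𝔞.map (algebraMap B Bₚ)) (Algebra.ofId B Bₚ) Ideal.le_comap_map).toLinearMap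

/-- Unfolding. [folklore] -/
@[simp] theorem quotientMapₗ_mk (b : B) :
    quotientMapₗ Bₚ 𝔞 (Ideal.Quotient.mk 𝔞 b) =
      Ideal.Quotient.mk (𝔞.map (algebraMap B Bₚ)) (algebraMap B Bₚ b) := rfl

/-- The localized submodule of `𝔞` in `B_P` is the extended ideal `𝔞 B_P`. [folklore] -/
theorem localized'_eq_map :
    𝔞.localized' Bₚ P (Algebra.linearMap B Bₚ) = (𝔞.map (algebraMap B Bₚ)) := by
  rw [Submodule.localized'_eq_span, Ideal.map]
  rfl

/-- **`B_P ⧸ 𝔞 B_P` is the localization of the module `B ⧸ 𝔞` at `P`.** [folklore] -/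
theorem isLocalizedModule_quotientMapₗ : IsLocalizedModule P (quotientMapₗ Bₚ 𝔞) := by
  let e : (Bₚ ⧸ 𝔞.localized' Bₚ P (Algebra.linearMap B Bₚ)) ≃ₗ[Bₚ] (Bₚ ⧸ 𝔞.map (algebraMap B Bₚ)) :=
    Submodule.quotEquivOfEq _ _ (localized'_eq_map P Bₚ 𝔞)
  have h : quotientMapₗ Bₚ 𝔞 =
      e.toLinearMap.restrictScalars B ∘ₗ 𝔞.toLocalizedQuotient' Bₚ P (Algebra.linearMap B Bₚ) := by
    apply LinearMap.ext
    intro x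
    induction x using Submodule.Quotient.induction_on with
    | H b => rfl
  rw [h]
  exact IsLocalizedModule.of_linearEquiv P (𝔞.toLocalizedQuotient' Bₚ P (Algebra.linearMap B Bₚ))
    (e.restrictScalars B)

include P in
/-- **`B_P ⧸ 𝔞 B_P = (B ⧸ 𝔞) ⊗_B B_P`**: the quotient map is a base change along the localization.
[folklore] -/
theorem isBaseChange_quotientMapₗ : IsBaseChange Bₚ (quotientMapₗ Bₚ 𝔞) :=
  (isLocalizedModule_iff_isBaseChange P Bₚ _).mp (isLocalizedModule_quotientMapₗ P Bₚ 𝔞)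

end Quotient

end Literature.AlgebraicGeometry.Resolution

end
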